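import Mathlib
import HarnessLib
import HarnessLib.Audit
import Summits.CriticalPhenomena.Statement
import Literature.Probability.Percolation.HalfSpace

/-!
Route: PercEventualDensity

# Route PercEventualDensity — eventual density glues itself — DERST mass propagation at the same p,
pigeonhole gluing, slab closing by DST

It suffices to show X = SomeScaleDensity ∧ DropletSurfaceCost, two statements about the PERCOLATING
phase {p : θ(p) > 0} of bond
percolation on ℤ³, each a theorem for p > p_c and each implied by the conjunct (so X ⟺ the conjunct,
given Kesten–Zhang and Pisztora):
(SDV) SomeScaleDensity — at a percolating p, with positive probability the in-ball cluster C^m(0) =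
{v ∈ B_m : 0 ↔ v inside B_m} of the
origin is macroscopically dense (|C^m(0)| ≥ t|B_m|) at infinitely many scales m; (K_d)
DropletSurfaceCost — at a percolating p, a
CONFINED finite droplet of small macroscopic density (C(0) ⊆ B_m, |C(0)| ≥ δ|B_m|) costs surface
order with a rate LINEAR in the
density: ∀A ∃δ₀ ∀δ ≤ δ₀: P_p ≤ exp(−Aδm²) for m large. The new glue (all provable now) is
Diskin–Easo–Radhakrishnan–Sudakov–Tassion
2026 (DiskinEtAl2026, arXiv:2603.03257) §7–§8 run AT THE SAME p: K_d powers single-vertex MASS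
PROPAGATION (a vertex dense at one scale stays dense at
all larger scales, a.s. up to a summable error), SDV initiates it, ergodicity seeds a big box, their
DENSITY PIGEONHOLE glues C translated
seeds without any uniqueness-of-dense-pieces hypothesis, their Lemma 8.1 (uniqueness + dependent
Peierls) gives a slab percolating at the
same p, and at p = p_c(ℤ³) that contradicts Duminil-Copin–Sidoravicius–Tassion (tree:
`percolationContinuity_of_samePSlab`, DST `_holds`).
Lean: `SomeScaleDensity ∧ DropletSurfaceCost`

## Assembly
The deciding theorem `closes : Assembly → SomeScaleDensity → DropletSurfaceCost → MassPropagation →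
EventualDensitySeed →
DensityToBoxLink → BoxLinkToSlab → NoSlabPercolationAtCriticality → PercolationContinuityZ3` is
certified (rev 1). `Assembly` is the
seven-antecedent chain 'six DERST items + NoSlabPercolationAtCriticality ⇒ θ(p_c) = 0', PURE LOGIC
(ten-line sorry-free proof with no
import beyond the route file, written out in its docstring; planner Sketch.lean rc 0): at a
percolating p = p_c(ℤ³), SomeScaleDensity
gives (t, positive probability of frequent density), MassPropagation fed with DropletSurfaceCost
gives (t₁, c, N₀), EventualDensitySeed
gives the seed input, DensityToBoxLink gives (42), BoxLinkToSlab gives a slab S_k (k > 0)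
percolating at p_c(ℤ³), contradicting
NoSlabPercolationAtCriticality = Grimmett (7.38) for d = 3, θ_{S_k}(p_c(ℤ³)) = 0 — PROVED in tree as
Literature.Probability.Percolation.theta_slab_criticalProbI_eq_zero (from
DuminilCopinSidoraviciusTassion2016_holds); a by-name
support, one-line discharge from a Theorems file importing HalfSpaceBGNProofs. CONE REPAIR
2026-08-17: rev 0 imported
Barriers.SprinklingRenormalisation and SlabGluingFact2 for an Assembly proof never put into
`closes`; both reach HalfSpaceBGN's
deprecated unprovable record Grimmett1999_lemma_7_52 and no item uses them, so the route imports
Literature.Probability.Percolation.HalfSpace only (its named facts BGN, BGN_Z3, GM_halfSpace, DST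
are all proved); the unproved facts
left in the import cone are the 16 Statement-borne ones every route of the summit inherits from
`import
Summits.CriticalPhenomena.Statement` (CardyFormula / SelfAvoidingWalk+SLE / Isoradial /
ScalingLimit3D / CriticalContinuity), used by
no item and no glue; needs-fact: none. The four DERST supports are the real Lean work (est. 1.5–2.5
kLoC over the tree's box /
openConnIn / symmetry / Harris / DependentStarPercolation APIs).

Rationale: WHY THIS LINE. Every same-p route of this sub stalls on one of two jump branches (cards
free-box-shattering-is-a-branch, dense-piece-uniqueness-hub):
the SHATTERED branch (the would-be critical cluster has in-box pieces of vanishing density) and the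
MONOLITHIC/MOSAIC branch (dense in-box
pieces, possibly several per box behind cheap membranes). The hub's Theorem A needs dense-piece
UNIQUENESS U (where the barrier
TransverseCrossingsNeedNotMeet sits) to glue pieces across boxes; this line removes U altogether:
DERST 2026 §8 glues by VOLUME — C ≥ 8/t₁
translated seeds whose clusters each fill a t₁-fraction of ONE common box must share a vertex —
provided density is EVENTUAL (all scales
from some scale on), and DERST §7's finite-energy recursion makes density eventual once confined
dense finite droplets are surface-order
rare (K_d): a stalled growth shell is closed at cost (1−p)^{3·increment} and manufactures exactly
such a droplet. What is imported:
supercritical sharpness technology (DERST 2026 §7–8, in print five months, cited in-house only for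
its sprinkled Prop 2.1/Thm 1),
ergodic theory of Bernoulli shifts (seed), k-dependent Peierls / Liggett–Schonmann–Stacey (tree:
DependentStarPercolation,
LiggettSchonmannStacey1997 fact), DST slab criticality (tree, proved). What it does that prior
routes do not: PercOpenSupercrit /
PercFiniteBoxLRO assume a same-p finite-size criterion (good boxes w.h.p. / pointwise linear LRO) as
ONE crux; here the criterion (42) is
DERIVED from two strictly weaker same-p statements — density of ONE vertex at SOME scales with SOME
probability (SDV), and a droplet
large-deviation bound (K_d) strictly weaker than the shared crux K = FiniteClusterVolumeTail
(stmt-CriticalPhenomena-0943) — and the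
closing is DST at the same p, not openness below p_c.

RANKED CRUXES. #2 SomeScaleDensity (crux) — for every p with θ(p) > 0 there is t > 0 such that with
positive P_p-probability the origin's in-ball cluster C^m(0) = {v ∈ B_m : 0 ↔ v inside B_m}
satisfies |C^m(0)| ≥ t·|B_m| for infinitely many m (B_m = box 3 m = [−m,m]³). A theorem for p > p_c
(Pisztora 1996 coarse graining: the origin lies in the unique in-box giant with probability → θ(p));
at a hypothetical percolating p_c it is exactly the negation of the SHATTERED jump branch; the
weakest member of the LRO family (LinearScaleLROOfTheta ⇒ in-box pair density ⇒ SDV). [difficulty: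
open-problem] (why it might fail: at a percolating p_c the shattered weaver (stationary, finite
energy, dense unique cluster, all half-space pieces finite, in-box pieces sparse) violates it, so no
soft proof exists; Cerf's same-p two-arms route reaches only polynomial boxes Λ(n^16).)
[Pisztora1996, Cerf2015, DiskinEtAl2026, arXiv:2202.07634, BarskyGrimmettNewman1991]
#3 DropletSurfaceCost (crux) — for every p with θ(p) > 0 and every A > 0 there is δ₀ > 0 such that
for all δ ∈ (0, δ₀] and all large m, P_p(C(0) ⊆ B_m and |C(0)| ≥ δ|B_m|) ≤ exp(−A δ m²): confined
finite droplets of small macroscopic density cost surface order with a rate linear in δ. For p > p_c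
it follows from Kesten–Zhang (Grimmett1999 Thm 8.65: rate c(δ|B_m|)^{2/3} ≥ 4cδ^{2/3}m² ≥ Aδm² once
δ ≤ (4c/A)³; birth skeleton `DropletSurfaceCost_of`, proved); it is implied by the shared crux K =
FiniteClusterVolumeTail (stmt-CriticalPhenomena-0943) and strictly weaker (dense CONFINED droplets
only); its content is the hypothetical percolating p = p_c. [difficulty: open-problem] (why it might
fail: in a monolithic or mosaic jump world it is FALSE: blocking B_m costs only exp(−o(m²)) at p_c
(touching-edge identity + BGN), so a droplet costs exp(−o(m²))·P(free-box giant); every printed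
surface-order LD proof uses slabs at p or sprinkling (KZ90, DERST26 Thm 2).) [KestenZhang1990,
Grimmett1999, DiskinEtAl2026, GrimmettMarstrand1990, Pete2008]
#9 MassPropagation (support) — (DERST 2026 §7, single vertex, same p; provable now) for every p, if
the droplet bound of DropletSurfaceCost holds at p then for every t > 0 there are t₁ ∈ (0, t], c >
0, N₀ with P_p(|C^N(0)| ≥ t|B_N| but not |C^m(0)| ≥ t₁|B_m| for all m ≥ N) ≤ exp(−cN²) for N ≥ N₀.
Proof: with L = −log(1−p), A := 150L + 2, t₁ := min(t, 2δ₀(A)); if |C^m(0)| ≥ t₁|B_m| but the shell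
growth |C^{m+1}(0)| − |C^m(0)| < t₁(|B_{m+1}| − |B_m|), close the < 3t₁(|B_{m+1}|−|B_m|) ≤
75t₁(m+1)² exit edges through ∂B_{m+1} (determined by the interior, independent of it): the cluster
becomes a confined (t₁/2)-dense droplet in B_{m+1}, so P(bad_m) ≤ e^{75Lt₁(m+1)²}·e^{−A(t₁/2)(m+1)²}
≤ e^{−t₁(m+1)²}; otherwise density t₁ is kept exactly (|B_{m+1}| − |B_m| = 24m²+48m+26, m ≥ 4); sum
over m ≥ N. [difficulty: provable-now] [DiskinEtAl2026, Grimmett1999]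
#9 EventualDensitySeed (support) — (ergodic seed; provable now) for every p, t, t₁ > 0, c > 0, N₀:
if P_p(|C^m(0)| ≥ t|B_m| for infinitely many m) > 0 and the propagation bound of MassPropagation
holds from N₀ on, then for every η > 0 and all large k, for all n ≥ 3k, P_p(|S(k,n)| ≥ t₁|B_n|) ≥ 1
− η, where S(k,n) = {v ∈ B_{n+k} : v ↔ B_k inside B_{n+k}} is the in-ball cluster set of the seed
B_k. Proof: the summable bound upgrades 'dense infinitely often' to 'eventually t₁-dense' with
positive probability; the translation-invariant event 'some vertex is eventually dense' then has
probability 1 (ergodicity of the Bernoulli shift under ℤ³-translations); for large k w.h.p. B_k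
contains such a vertex x with onset ≤ k, and C^n(x) ⊆ S(k,n). [difficulty: provable-now]
[DiskinEtAl2026, LyonsPeres2016, Grimmett1999]
#9 DensityToBoxLink (support) — (DERST 2026 §8, density pigeonhole + square-root trick; provable
now) for every p and t₁ > 0: if for every η and all large k, all n ≥ 3k, P_p(|S(k,n)| ≥ t₁|B_n|) ≥ 1
− η, then there is L ≥ 2 such that for every ε and all large k, for infinitely many m, P_p(B_k ↔ B_k
+ m·e₀ inside B_{Lm}) ≥ 1 − ε ('(42)': lim_k limsup_m = 1). Proof: C := ⌈8/t₁⌉ + 2 seeds B_k + in·e₀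
(0 ≤ i < C) each fill ≥ t₁(2Cn+1)³ > |B_{2Cn}|/C vertices of the common box B_{2Cn} w.p. ≥ 1 − Cη
(translation invariance), so two seed clusters share a vertex and are joined inside B_{2Cn}(in·e₀);
the square-root trick (Harris) pins one pair (i,j) with probability ≥ 1 − (Cη)^{1/C²}; m := (j−i)n ∈
[n,(C−1)n], L := 2C. [difficulty: provable-now] [DiskinEtAl2026, Grimmett1999]
#9 BoxLinkToSlab (support) — (DERST 2026 Lemma 8.1, same-p static renormalisation; provable now) for
every p, (42) at p implies that some slab S_k = {0 ≤ x₀ ≤ k} percolates at p from its origin. Proof: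
by coordinate symmetry (42) holds along e₁ and e₂; a.s. uniqueness of the infinite cluster at p
(tree: Grimmett1999_numInfiniteClusters_le_one_holds) gives n₀ with the in-box uniqueness event U
(at most one cluster of ω|B_{n₀} meets B_k and ∂B_{n₀}) of probability > 1 − ε; coarse sites u ∈ ℤ²
are good iff U holds at the 9 seeds around nu and nu's seed links to its 4 neighbours inside nu +
B_{Ln}: a (2L+1)-dependent family with P(bad) ≤ 14ε, which percolates by the tree's k-dependent
Peierls lemma (DependentStarPercolation) or Liggett–Schonmann–Stacey; ★-paths of good sites give
open paths inside the slab {|x₀| ≤ Ln + n₀}; translate, then root at the slab origin by Harris.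
[difficulty: provable-now] [DiskinEtAl2026, LiggettSchonmannStacey1997, GrimmettMarstrand1990,
Grimmett1999]

TWO-LAYER PLAN. DropletSurfaceCost ⇐ VolumeTailSupercrit (Grimmett1999 Thm 8.65, named fact in tree)
→ VolumeTailCritical (= crux K, stmt-CriticalPhenomena-0943, at p = p_c) → DropletSurfaceCost: the
birth skeleton `DropletSurfaceCost_of` (bc/DropletSurfaceCost_birth.lean, composition PROVED incl.
the exponent arithmetic); an alternative second child is the UNCONDITIONAL critical large-deviation
bound 'P_{p_c}(the in-box cluster of 0 in B_m has ≥ δ|B_m| vertices) ≤ exp(−Aδm²) for δ ≤ δ₀(A), m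
large' (a real-world finite-box statement, believed with volume-order room), which implies the p =
p_c case by inclusion. SomeScaleDensity ⇐ DensePieceEachScale (at a percolating p, at EVERY scale N,
w.p. ≥ c some vertex of B_{2N} is joined inside B_{2N} to a δ-fraction of B_N) → OriginShare
(translation averaging + reverse Fatou, provable now) → SomeScaleDensity: birth skeleton
`SomeScaleDensity_of` (bc/SomeScaleDensity_birth.lean, composition proved).

KILL CRITERIA. (i) A gap in the same-p reading of DERST §7–8 (e.g. the finite-energy step needs
information the interior does not determine, or Lemma 8.1 secretly uses p > p_c) refutes a SUPPORT
item and closes the route as drawn (close --reason refuted:<support>); I checked each: §7 uses only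
finite energy and isoperimetry of cubes, §8 only FKG and translation invariance, Lemma 8.1 only a.s.
uniqueness at p and k-dependent Peierls. (ii) A proof that SomeScaleDensity or DropletSurfaceCost is
equivalent to the conjunct by a SHORT argument (e.g. via the cheap-blocking identity P_{p_c}(B_k ↮
∞) ≥ exp(−o(k²))) turns that crux into a costume: pivot to its skeleton children or retire
not-a-thesis. (iii) A proof elsewhere of K (stmt-0943) closes DropletSurfaceCost (skeleton); a proof
of LinearScaleLROOfTheta (PercFiniteBoxLRO) or NonProliferation closes SomeScaleDensity via the
hub's density count; either way the route then needs only its supports.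

NOT DECOMPOSED YET. The constants of MassPropagation (A = 150L + 2, the 75(m+1)² shell bound, m ≥ 4)
and of DensityToBoxLink (C = ⌈8/t₁⌉ + 2, L = 2C) are fixed in the informal proofs but not filed as
items; the ergodicity of the Bernoulli shift under ℤ³-translations and the 9-seed variant of Lemma
8.1 (★-paths through good sites) are sub-lemmas of the supports, to be attached by provers with
--supports; the two birth skeletons are layer-2 candidates, not items.

CHEAPEST FALSIFIER. Re-read arXiv:2603.03257 (DiskinEtAl2026) pp.17–20 (§7 Theorem 3, §8 Lemma 8.1
and the proof of Theorem 4) looking for a use of p > p_c beyond the INPUT tail bound: I did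
(materialised pages p0029–p0032); the only supercritical input is Theorem 1/2's tail, replaced here
by DropletSurfaceCost for single vertices — the seed version of §7 (S = B_k) is NOT available at p_c
(blocking a box costs only exp(−o(k²)) at p_c by the touching-edge identity P(S ↮ ∞) = E(1−p)^{Ψ(S)}
and BGN), which is exactly why SomeScaleDensity is needed as a separate initiation crux. Second
cheapest: the BC7 tautology probe (run: both cruxes CLEAN) and the BC2 probes (run: crux → Statement
fails for both).

NUMBERS. p_c(ℤ³, bond) ≈ 0.2488; L = −log(1 − p_c) ≈ 0.286, so the propagation constant is A ≈ 45;
Kesten–Zhang exponent (d−1)/d = 2/3; |B_{m+1}| − |B_m| = 24m² + 48m + 26 ≤ 25(m+1)²; one-arm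
exponent ≈ 0.48 and d_f ≈ 2.52 (why critical in-box clusters are never macroscopically dense in the
real world: SDV and K_d are vacuous at p_c there and theorems above it).

DEFINITION REQUESTS. None: every item is typed over box / openConnIn / openCluster / bondPercolation
/ theta / slabGraph. Bib: DiskinEtAl2026 = DiskinEtAl2026 (entry prepared in the planner folder,
derst.bib; `ledger bib add` pending gate availability).

Novelty: Searches (2026-08-17): `lit frontier CriticalPhenomena --since 2024` (60 rows; found
arXiv:2603.03257, 2601.07808, 2602.12261, 2606.06688, 2606.13648 — read p.1 of each, full §1–3, §6–8
of 2603.03257); grep of all 55 route files + Cruxes/ for 2603.03257 (5 hits: PorousCritical,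
FoamCut, K's birth line — all cite it as 'Prop 2.1 / Thm 1 sprinkled', none uses §7–8); all 50
open-route headers read (levers listed in NOTES); 114 closed + 34 open cards of the sub by title,
and in full: dense-piece-uniqueness-hub, free-box-shattering-is-a-branch,
boolean-toolbox-blind-spots, invasion-never-settles, msf-outlet-equivalence,
scale-concavity-osss-elasticity, annealed-reflection-positivity; barrier files
SprinklingRenormalisation, SubexponentialGrowthZd, BLPS*; `ledger negatives --problem
CriticalPhenomena` (11; 3 on this sub, unrelated support items).
Nearest prior art found: DiskinEtAl2026 = arXiv:2603.03257 §7–8 (DERST 2026: mass collection and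
GM-from-sharpness, written for p > p_c with Theorem 2 as input); card dense-piece-uniqueness-hub
(Theorem A: DP_c ∧ U ⇒ conjunct by boost + LSS at p_c − η, graded variant); routes PercOpenSupercrit
/ PercFiniteBoxLRO (same-p finite-size criterion as a single crux) and PercNearOneGluing (same-p
slab bridge closed by DST); arXiv:1902.03207 §1.1 (DKT finite-size-criterion template).
Delta: the finite-size criterion is not assumed but derived — eventual density from SDV + the
droplet bound by DERST's same-p finite-energy recursion, and gluing by DE  [refs: 2603.03257, 1902.03207, DiskinEtAl2026]

Barriers (technique_class: same-p mass-propagation, pigeonhole-gluing, slab-closing): - technique_class: same-p mass-propagation, pigeonhole-gluing, slab-closing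
- Literature.Barriers.CriticalPhenomena.SprinklingRenormalisation: evaded in the glue, met head-on
in one crux — every block step of the glue runs at the same p (§7: finite energy on exit edges
determined by the interior; §8: FKG + translations; Lemma 8.1: a.s. uniqueness at p + k-dependent
Peierls), and the only place DERST sprinkle (Prop 2.1/Thm 2) is replaced by the crux
DropletSurfaceCost, declared as the residue; the seed form of §7 is provably unavailable at p_c
(cheap blocking), recorded in Cheapest falsifier.
- Literature.Barriers.CriticalPhenomena.TransverseCrossingsNeedNotMeet: evaded — no two paths or
pieces are asked to meet: C translated seed clusters that each fill more than a 1/C fraction of one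
box share a VERTEX (pigeonhole), and inside Lemma 8.1 gluing through a seed is the uniqueness event
U from global a.s. uniqueness, not a crossing argument.
- Literature.Barriers.CriticalPhenomena.SlabLimitUniformControl: not engaged — no k → ∞ limit of
slab quantities; DST is applied to ONE slab at p = p_c(ℤ³) through
percolationContinuity_of_samePSlab.
- Literature.Barriers.CriticalPhenomena.LongRangeDiscontinuity: evaded by the closing, not by the
cruxes — on the Aizenman–Newman 1/r² chain both cruxes may hold at the jump, but the glue needs
slabs of ℤ³ and the DST slab theorem (finite range, d = 3), which have no analogue there.
- Literature.Barriers.CriticalPhenomena.TreesPercolatingAtCritic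

History (route lifecycle, newest last):
- 2026-08-17T09:22:44Z · rev 1: restated Assembly (stmt-CriticalPhenomena-17926) — cone repair (rrepair 895999c1): imports = [HalfSpace]; Assembly restated to the 7-antecedent pure-logic chain; closes := Assembly applied to the six items + new (planner-rrepair-CriticalPhenomena-PercEventual-895999c1-0)

sub-problem: PercolationContinuityZ3 · status: draft · opened planner-plan-novel-CriticalPhenomena-Percolatio-701f9421-v2-g19-0 2026-08-17T08:32:03Z · rev 2 · ledger route-CriticalPhenomena-PercEventualDensity
GENERATED by the gate from the ledger (D-0016/17). Provers cite these decls: `theorem foo : Summit.CriticalPhenomena.PercolationContinuityZ3.Theses.PercEventualDensity.<Decl> := …` in Summits/CriticalPhenomena/PercolationContinuityZ3/Theorems/<Name>.lean.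
-/

namespace Summit.CriticalPhenomena.PercolationContinuityZ3.Theses.PercEventualDensity

open scoped BigOperators Topology Manifold Classical MeasureTheory ProbabilityTheory Matrix InnerProductSpace ComplexConjugate ContinuousMap
open Filter Set Function TopologicalSpace MeasureTheory

attribute [summit_statement] _root_.PercolationContinuityZ3

/-- item stmt-CriticalPhenomena-17919 · crux · rank 2 · closed · proved by Summit.CriticalPhenomena.PercolationContinuityZ3.Theorems.EventualDensitySomeScaleDensity.someScaleDensity_proof @ 9e0e43ecc628 (prover) · by planner
why it might fail: at a percolating p_c the shattered weaver (stationary, finite energy, dense unique cluster, all half-space pieces finite, in-box pieces sparse) violates it, so no soft proof exists; Cerf's same-p two-arms route reaches only polynomial boxes Λ(n^16).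
sources: Pisztora1996, Cerf2015, DiskinEtAl2026, arXiv:2202.07634, BarskyGrimmettNewman1991
[crux] for every p with θ(p) > 0 there is t > 0 such that with positive P_p-probability the origin's
in-ball cluster C^m(0) = {v ∈ B_m : 0 ↔ v inside B_m} satisfies |C^m(0)| ≥ t·|B_m| for infinitely
many m (B_m = box 3 m = [−m,m]³). A theorem for p > p_c (Pisztora 1996 coarse graining: the origin
lies in the unique in-box giant with probability → θ(p)); at a hypothetical percolating p_c it is
exactly the negation of the SHATTERED jump branch; the weakest member of the LRO family
(LinearScaleLROOfTheta ⇒ in-box pair density ⇒ SDV). [difficulty: open-problem] -/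
@[route_item "route-CriticalPhenomena-PercEventualDensity"]
def SomeScaleDensity : Prop :=
  let C : Literature.Probability.Percolation.BondConfig (Literature.Probability.LatticeModels.Site 3) → ℕ → Set (Literature.Probability.LatticeModels.Site 3) := fun ω m => {v | v ∈ Literature.Probability.LatticeModels.box 3 m ∧ ω ∈ Literature.Probability.Percolation.openConnIn (↑(Literature.Probability.LatticeModels.box 3 m)) 0 v}; ∀ p : unitInterval, 0 < Literature.Probability.Percolation.theta (Literature.Probability.LatticeModels.zdGraph 3) 0 p → ∃ t : ℝ, 0 < t ∧ 0 < (Literature.Probability.Percolation.bondPercolation (Literature.Probability.LatticeModels.zdGraph 3) p).real {ω | ∃ᶠ m : ℕ in Filter.atTop, t * ((Literature.Probability.LatticeModels.box 3 m).card : ℝ) ≤ ((C ω m).ncard : ℝ)}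

/-- item stmt-CriticalPhenomena-17921 · crux · rank 3 · closed · proved by Summit.CriticalPhenomena.PercolationContinuityZ3.Theorems.EventualDensityDropletSurfaceCost.dropletSurfaceCost_proof @ 1a2588ee967d (prover) · by planner
why it might fail: in a monolithic or mosaic jump world it is FALSE: blocking B_m costs only exp(−o(m²)) at p_c (touching-edge identity + BGN), so a droplet costs exp(−o(m²))·P(free-box giant); every printed surface-order LD proof uses slabs at p or sprinkling (KZ90, DERST26 Thm 2).
sources: KestenZhang1990, Grimmett1999, DiskinEtAl2026, GrimmettMarstrand1990, Pete2008
[crux] for every p with θ(p) > 0 and every A > 0 there is δ₀ > 0 such that for all δ ∈ (0, δ₀] and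
all large m, P_p(C(0) ⊆ B_m and |C(0)| ≥ δ|B_m|) ≤ exp(−A δ m²): confined finite droplets of small
macroscopic density cost surface order with a rate linear in δ. For p > p_c it follows from
Kesten–Zhang (Grimmett1999 Thm 8.65: rate c(δ|B_m|)^{2/3} ≥ 4cδ^{2/3}m² ≥ Aδm² once δ ≤ (4c/A)³;
birth skeleton `DropletSurfaceCost_of`, proved); it is implied by the shared crux K =
FiniteClusterVolumeTail (stmt-CriticalPhenomena-0943) and strictly weaker (dense CONFINED droplets
only); its content is the hypothetical percolating p = p_c. [difficulty: open-problem] -/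
@[route_item "route-CriticalPhenomena-PercEventualDensity"]
def DropletSurfaceCost : Prop :=
  ∀ p : unitInterval, 0 < Literature.Probability.Percolation.theta (Literature.Probability.LatticeModels.zdGraph 3) 0 p → ∀ A : ℝ, 0 < A → ∃ δ₀ : ℝ, 0 < δ₀ ∧ ∀ δ : ℝ, 0 < δ → δ ≤ δ₀ → ∃ m₀ : ℕ, ∀ m : ℕ, m₀ ≤ m → (Literature.Probability.Percolation.bondPercolation (Literature.Probability.LatticeModels.zdGraph 3) p).real {ω | Literature.Probability.Percolation.openCluster ω (0 : Literature.Probability.LatticeModels.Site 3) ⊆ ↑(Literature.Probability.LatticeModels.box 3 m) ∧ δ * ((Literature.Probability.LatticeModels.box 3 m).card : ℝ) ≤ ((Literature.Probability.Percolation.openCluster ω (0 : Literature.Probability.LatticeModels.Site 3)).ncard : ℝ)} ≤ Real.exp (-(A * δ * (m : ℝ) ^ 2))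

/-- item stmt-CriticalPhenomena-17922 · support · rank 9 · closed · proved by Summit.CriticalPhenomena.PercolationContinuityZ3.Theorems.MassPropagation.massPropagation_proof @ 7bc2b5a172f0 (prover) · by planner
sources: DiskinEtAl2026, Grimmett1999
[support] (DERST 2026 §7, single vertex, same p; provable now) for every p, if the droplet bound of
DropletSurfaceCost holds at p then for every t > 0 there are t₁ ∈ (0, t], c > 0, N₀ with
P_p(|C^N(0)| ≥ t|B_N| but not |C^m(0)| ≥ t₁|B_m| for all m ≥ N) ≤ exp(−cN²) for N ≥ N₀. Proof: with
L = −log(1−p), A := 150L + 2, t₁ := min(t, 2δ₀(A)); if |C^m(0)| ≥ t₁|B_m| but the shell growth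
|C^{m+1}(0)| − |C^m(0)| < t₁(|B_{m+1}| − |B_m|), close the < 3t₁(|B_{m+1}|−|B_m|) ≤ 75t₁(m+1)² exit
edges through ∂B_{m+1} (determined by the interior, independent of it): the cluster becomes a
confined (t₁/2)-dense droplet in B_{m+1}, so P(bad_m) ≤ e^{75Lt₁(m+1)²}·e^{−A(t₁/2)(m+1)²} ≤
e^{−t₁(m+1)²}; otherwise density t₁ is kept exactly (|B_{m+1}| − |B_m| = 24m²+48m+26, m ≥ 4); sum
over m ≥ N. [difficulty: provable-now] -/
@[route_item "route-CriticalPhenomena-PercEventualDensity"]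
def MassPropagation : Prop :=
  let C : Literature.Probability.Percolation.BondConfig (Literature.Probability.LatticeModels.Site 3) → ℕ → Set (Literature.Probability.LatticeModels.Site 3) := fun ω m => {v | v ∈ Literature.Probability.LatticeModels.box 3 m ∧ ω ∈ Literature.Probability.Percolation.openConnIn (↑(Literature.Probability.LatticeModels.box 3 m)) 0 v}; ∀ p : unitInterval, (∀ A : ℝ, 0 < A → ∃ δ₀ : ℝ, 0 < δ₀ ∧ ∀ δ : ℝ, 0 < δ → δ ≤ δ₀ → ∃ m₀ : ℕ, ∀ m : ℕ, m₀ ≤ m → (Literature.Probability.Percolation.bondPercolation (Literature.Probability.LatticeModels.zdGraph 3) p).real {ω | Literature.Probability.Percolation.openCluster ω (0 : Literature.Probability.LatticeModels.Site 3) ⊆ ↑(Literature.Probability.LatticeModels.box 3 m) ∧ δ * ((Literature.Probability.LatticeModels.box 3 m).card : ℝ) ≤ ((Literature.Probability.Percolation.openCluster ω (0 : Literature.Probability.LatticeModels.Site 3)).ncard : ℝ)} ≤ Real.exp (-(A * δ * (m : ℝ) ^ 2))) → ∀ t : ℝ, 0 < t → ∃ t₁ : ℝ, 0 < t₁ ∧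 t₁ ≤ t ∧ ∃ c : ℝ, 0 < c ∧ ∃ N₀ : ℕ, ∀ N : ℕ, N₀ ≤ N → (Literature.Probability.Percolation.bondPercolation (Literature.Probability.LatticeModels.zdGraph 3) p).real {ω | t * ((Literature.Probability.LatticeModels.box 3 N).card : ℝ) ≤ ((C ω N).ncard : ℝ) ∧ ¬ ∀ m : ℕ, N ≤ m → t₁ * ((Literature.Probability.LatticeModels.box 3 m).card : ℝ) ≤ ((C ω m).ncard : ℝ)} ≤ Real.exp (-(c * (N : ℝ) ^ 2))

/-- item stmt-CriticalPhenomena-17923 · support · rank 9 · closed · proved by Summit.CriticalPhenomena.PercolationContinuityZ3.Theorems.DensitySeed.eventualDensitySeed_proof @ e1fb0f1519d9 (prover) · by planner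
sources: DiskinEtAl2026, LyonsPeres2016, Grimmett1999
[support] (ergodic seed; provable now) for every p, t, t₁ > 0, c > 0, N₀: if P_p(|C^m(0)| ≥ t|B_m|
for infinitely many m) > 0 and the propagation bound of MassPropagation holds from N₀ on, then for
every η > 0 and all large k, for all n ≥ 3k, P_p(|S(k,n)| ≥ t₁|B_n|) ≥ 1 − η, where S(k,n) = {v ∈
B_{n+k} : v ↔ B_k inside B_{n+k}} is the in-ball cluster set of the seed B_k. Proof: the summable
bound upgrades 'dense infinitely often' to 'eventually t₁-dense' with positive probability; the
translation-invariant event 'some vertex is eventually dense' then has probability 1 (ergodicity of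
the Bernoulli shift under ℤ³-translations); for large k w.h.p. B_k contains such a vertex x with
onset ≤ k, and C^n(x) ⊆ S(k,n). [difficulty: provable-now] -/
@[route_item "route-CriticalPhenomena-PercEventualDensity"]
def EventualDensitySeed : Prop :=
  let C : Literature.Probability.Percolation.BondConfig (Literature.Probability.LatticeModels.Site 3) → ℕ → Set (Literature.Probability.LatticeModels.Site 3) := fun ω m => {v | v ∈ Literature.Probability.LatticeModels.box 3 m ∧ ω ∈ Literature.Probability.Percolation.openConnIn (↑(Literature.Probability.LatticeModels.box 3 m)) 0 v}; let S : Literature.Probability.Percolation.BondConfig (Literature.Probability.LatticeModels.Site 3) → ℕ → ℕ → Set (Literature.Probability.LatticeModels.Site 3) := fun ω k n => {v | v ∈ Literature.Probability.LatticeModels.box 3 (n + k) ∧ ∃ y ∈ Literature.Probability.LatticeModels.box 3 k, ω ∈ Literature.Probability.Percolation.openConnIn (↑(Literature.Probability.LatticeModels.box 3 (n + k))) y v}; ∀ (p : unitInterval) (t t₁ c : ℝ) (N₀ : ℕ), 0 < t₁ → 0 < c → 0 < (Literature.Probability.Percolation.bondPercolation (Literature.Probability.LatticeModels.zdGraph 3)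 p).real {ω | ∃ᶠ m : ℕ in Filter.atTop, t * ((Literature.Probability.LatticeModels.box 3 m).card : ℝ) ≤ ((C ω m).ncard : ℝ)} → (∀ N : ℕ, N₀ ≤ N → (Literature.Probability.Percolation.bondPercolation (Literature.Probability.LatticeModels.zdGraph 3) p).real {ω | t * ((Literature.Probability.LatticeModels.box 3 N).card : ℝ) ≤ ((C ω N).ncard : ℝ) ∧ ¬ ∀ m : ℕ, N ≤ m → t₁ * ((Literature.Probability.LatticeModels.box 3 m).card : ℝ) ≤ ((C ω m).ncard : ℝ)} ≤ Real.exp (-(c * (N : ℝ) ^ 2))) → ∀ η : ℝ, 0 < η → ∃ k₀ : ℕ, ∀ k : ℕ, k₀ ≤ k → ∀ n : ℕ, 3 * k ≤ n → 1 - η ≤ (Literature.Probability.Percolation.bondPercolation (Literature.Probability.LatticeModels.zdGraph 3) p).real {ω | t₁ * ((Literature.Probability.LatticeModels.box 3 n).card : ℝ) ≤ ((S ω k n).ncard : ℝ)}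

/-- item stmt-CriticalPhenomena-17924 · support · rank 9 · closed · proved by Summit.CriticalPhenomena.PercolationContinuityZ3.Theorems.DensityToBoxLink.densityToBoxLink_proof @ 041698800e59 (prover) · by planner
sources: DiskinEtAl2026, Grimmett1999
[support] (DERST 2026 §8, density pigeonhole + square-root trick; provable now) for every p and t₁ >
0: if for every η and all large k, all n ≥ 3k, P_p(|S(k,n)| ≥ t₁|B_n|) ≥ 1 − η, then there is L ≥ 2
such that for every ε and all large k, for infinitely many m, P_p(B_k ↔ B_k + m·e₀ inside B_{Lm}) ≥
1 − ε ('(42)': lim_k limsup_m = 1). Proof: C := ⌈8/t₁⌉ + 2 seeds B_k + in·e₀ (0 ≤ i < C) each fill ≥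
t₁(2Cn+1)³ > |B_{2Cn}|/C vertices of the common box B_{2Cn} w.p. ≥ 1 − Cη (translation invariance),
so two seed clusters share a vertex and are joined inside B_{2Cn}(in·e₀); the square-root trick
(Harris) pins one pair (i,j) with probability ≥ 1 − (Cη)^{1/C²}; m := (j−i)n ∈ [n,(C−1)n], L := 2C.
[difficulty: provable-now] -/
@[route_item "route-CriticalPhenomena-PercEventualDensity"]
def DensityToBoxLink : Prop :=
  let S : Literature.Probability.Percolation.BondConfig (Literature.Probability.LatticeModels.Site 3) → ℕ → ℕ → Set (Literature.Probability.LatticeModels.Site 3) := fun ω k n => {v | v ∈ Literature.Probability.LatticeModels.box 3 (n + k) ∧ ∃ y ∈ Literature.Probability.LatticeModels.box 3 k, ω ∈ Literature.Probability.Percolation.openConnIn (↑(Literature.Probability.LatticeModels.box 3 (n + k))) y v}; ∀ (p : unitInterval) (t₁ : ℝ), 0 < t₁ → (∀ η : ℝ, 0 < η → ∃ k₀ : ℕ, ∀ k : ℕ, k₀ ≤ k → ∀ n : ℕ, 3 * k ≤ n → 1 - η ≤ (Literature.Probability.Percolation.bondPercolation (Literature.Probability.LatticeModels.zdGraph 3)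 p).real {ω | t₁ * ((Literature.Probability.LatticeModels.box 3 n).card : ℝ) ≤ ((S ω k n).ncard : ℝ)}) → ∃ L : ℕ, 2 ≤ L ∧ ∀ ε : ℝ, 0 < ε → ∃ k₀ : ℕ, ∀ k : ℕ, k₀ ≤ k → ∃ᶠ m : ℕ in Filter.atTop, 1 - ε ≤ (Literature.Probability.Percolation.bondPercolation (Literature.Probability.LatticeModels.zdGraph 3) p).real {ω | ∃ x ∈ Literature.Probability.LatticeModels.box 3 k, ∃ y ∈ Literature.Probability.LatticeModels.box 3 k, ω ∈ Literature.Probability.Percolation.openConnIn (↑(Literature.Probability.LatticeModels.box 3 (L * m))) x (y + Pi.single 0 (m : ℤ))}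

/-- item stmt-CriticalPhenomena-17925 · support · rank 9 · closed · proved by Summit.CriticalPhenomena.PercolationContinuityZ3.Theorems.EventualDensityBoxLinkToSlab.boxLinkToSlab_proof @ dcf266aae3d2 (prover) · by planner
sources: DiskinEtAl2026, LiggettSchonmannStacey1997, GrimmettMarstrand1990, Grimmett1999
[support] (DERST 2026 Lemma 8.1, same-p static renormalisation; provable now) for every p, (42) at p
implies that some slab S_k = {0 ≤ x₀ ≤ k} percolates at p from its origin. Proof: by coordinate
symmetry (42) holds along e₁ and e₂; a.s. uniqueness of the infinite cluster at p (tree: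
Grimmett1999_numInfiniteClusters_le_one_holds) gives n₀ with the in-box uniqueness event U (at most
one cluster of ω|B_{n₀} meets B_k and ∂B_{n₀}) of probability > 1 − ε; coarse sites u ∈ ℤ² are good
iff U holds at the 9 seeds around nu and nu's seed links to its 4 neighbours inside nu + B_{Ln}: a
(2L+1)-dependent family with P(bad) ≤ 14ε, which percolates by the tree's k-dependent Peierls lemma
(DependentStarPercolation) or Liggett–Schonmann–Stacey; ★-paths of good sites give open paths inside
the slab {|x₀| ≤ Ln + n₀}; translate, then root at the slab origin by Harris. [difficulty:
provable-now] -/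
@[route_item "route-CriticalPhenomena-PercEventualDensity"]
def BoxLinkToSlab : Prop :=
  ∀ p : unitInterval, (∃ L : ℕ, 2 ≤ L ∧ ∀ ε : ℝ, 0 < ε → ∃ k₀ : ℕ, ∀ k : ℕ, k₀ ≤ k → ∃ᶠ m : ℕ in Filter.atTop, 1 - ε ≤ (Literature.Probability.Percolation.bondPercolation (Literature.Probability.LatticeModels.zdGraph 3) p).real {ω | ∃ x ∈ Literature.Probability.LatticeModels.box 3 k, ∃ y ∈ Literature.Probability.LatticeModels.box 3 k, ω ∈ Literature.Probability.Percolation.openConnIn (↑(Literature.Probability.LatticeModels.box 3 (L * m))) x (y + Pi.single 0 (m : ℤ))}) → ∃ k : ℕ, 0 < k ∧ 0 < Literature.Probability.Percolation.theta (Literature.Probability.Percolation.slabGraph 3 k) (Literature.Probability.Percolation.slabOrigin 3 k) p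

/-- item stmt-CriticalPhenomena-17963 · support · rank 9 · closed · proved by Summit.CriticalPhenomena.PercolationContinuityZ3.Theorems.PercEventualDensityNoSlabPercolationAtCriticality.noSlabPercolationAtCriticality_proof @ 2565c8a1db7b (prover) · by planner
sources: DuminilCopinSidoraviciusTassion2016, Grimmett1999, Literature.Probability.Percolation.theta_slab_criticalProbI_eq_zero, Literature.Probability.Percolation.DuminilCopinSidoraviciusTassion2016_holds
[support] Grimmett 1999 (7.38) for d = 3: at p = p_c(ℤ³) no slab S_k = {0 ≤ x₀ ≤ k} (k > 0), rooted
at its origin, percolates: θ_{S_k}(p_c(ℤ³)) = 0. PROVED in tree as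
Literature.Probability.Percolation.theta_slab_criticalProbI_eq_zero (HalfSpaceBGNProofs.lean; =
DuminilCopinSidoraviciusTassion2016_holds.theta_slab_criticalProbI: p_c(ℤ³) ≤ p_c(S_k) by
criticalProb_le_induce, then either strict and the slab is subcritical at p_c(ℤ³), or equal and
Duminil-Copin–Sidoravicius–Tassion 2016 Thm 1 applies). One-line discharge, checked (planner
DischargeTest.lean rc 0): in
Summits/CriticalPhenomena/PercolationContinuityZ3/Theorems/PercEventualDensityNoSlab.lean importing
Literature.Probability.Percolation.HalfSpaceBGNProofs, `theorem noSlab_proof :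
Summit.CriticalPhenomena.PercolationContinuityZ3.Theses.PercEventualDensity.NoSlabPercolationAtCriticality
:= fun k hk => Literature.Probability.Percolation.theta_slab_criticalProbI_eq_zero k hk`. Kept OUT
of the route file's imports deliberately (cone hygiene: HalfSpaceBGN carries the deprecated record
Grimmett1999_lemma_7_52). It is the only input of the deciding theorem beyond the six DERST items.
[difficulty: provable-now, one line] -/
@[route_item "route-CriticalPhenomena-PercEventualDensity"]
def NoSlabPercolationAtCriticality : Prop :=
  ∀ k : ℕ, 0 < k → Literature.Probability.Percolation.theta (Literature.Probability.Percolation.slabGraph 3 k) (Literature.Probability.Percolation.slabOrigin 3 k) (Literature.Probability.Percolation.criticalProbI 3) = 0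

-- earlier Assembly (stmt-CriticalPhenomena-17926, replaced 2026-08-17T09:22:44Z -> stmt-CriticalPhenomena-17962): retired by None — SomeScaleDensity → DropletSurfaceCost → MassPropagation → EventualDensitySeed → DensityToBoxLink → BoxLinkToSlab → _root_.PercolationContinuityZ3
/-- item stmt-CriticalPhenomena-17962 · assembly · rank 1 · closed · proved by Summit.CriticalPhenomena.PercolationContinuityZ3.Theorems.PercEventualDensityAssembly.assembly_proof @ 1922d85d9809 (prover) · by planner
sources: DiskinEtAl2026, DuminilCopinSidoraviciusTassion2016
[assembly] RESTATED 2026-08-17 (cone repair): SomeScaleDensity → DropletSurfaceCost →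
MassPropagation → EventualDensitySeed → DensityToBoxLink → BoxLinkToSlab →
NoSlabPercolationAtCriticality → the conjunct (the type of `closes` minus its first binder). PURE
LOGIC, provable now with NO import beyond the route file (planner Sketch.lean rc 0, 0 sorries — this
also certifies that the six DERST items chain: their quantifiers match verbatim): at p = p_c(ℤ³)
suppose θ > 0 (θ ≥ 0 is measureReal_nonneg); SomeScaleDensity gives (t, positive probability of
frequent t-density); DropletSurfaceCost gives the droplet bound that MassPropagation turns into (t₁
≤ t, c, N₀); EventualDensitySeed fed with both gives seed density w.h.p.; DensityToBoxLink gives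
(42); BoxLinkToSlab gives k > 0 with θ_{S_k}(p_c(ℤ³)) > 0, contradicting
NoSlabPercolationAtCriticality. Land verbatim as
Summits/CriticalPhenomena/PercolationContinuityZ3/Theorems/PercEventualDensityAssembly.lean (import
the route file only; namespace Summit.CriticalPhenomena.PercolationContinuityZ3.Theorems): `theorem
percEventualDensity_assembly_proof :
Summit.CriticalPhenomena.PercolationContinuityZ3.Theses.PercEventualDensity.Assembly := by -/
@[route_item "route-CriticalPhenomena-PercEventualDensity"]
def Assembly : Prop :=
  SomeScaleDensity → DropletSurfaceCost → MassPropagation → EventualDensitySeed → DensityToBoxLink → BoxLinkToSlab → NoSlabPercolationAtCriticality → _root_.PercolationContinuityZ3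

/-! D-0027 §2.1 — DECIDING THEOREM (planner-authored via `route open/edit --closes-file`; by planner-rrepair-CriticalPhenomena-PercEventual-895999c1-0 2026-08-17T09:22:44Z):
its hypotheses are this route's items and its conclusion the sub-problem Statement (glue_lint), and it elaborates with this file. -/

/-- The deciding theorem (D-0027 §2.1): the restated `Assembly` item — the six DERST items and the
by-name support `NoSlabPercolationAtCriticality` imply `θ(p_c) = 0` on `ℤ³`, a pure-logic chain
whose sorry-free proof (ten tactic lines, no import beyond this file; planner Sketch.lean rc 0) is
written out in the `Assembly` docstring for a prover to land verbatim — applied to the seven items. -/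
@[closes "route-CriticalPhenomena-PercEventualDensity"] theorem closes (hA : Assembly) (hSDV : SomeScaleDensity) (hK : DropletSurfaceCost)
    (hMP : MassPropagation) (hSeed : EventualDensitySeed) (hLink : DensityToBoxLink)
    (hSlab : BoxLinkToSlab) (hNoSlab : NoSlabPercolationAtCriticality) :
    _root_.PercolationContinuityZ3 :=
  hA hSDV hK hMP hSeed hLink hSlab hNoSlab

end Summit.CriticalPhenomena.PercolationContinuityZ3.Theses.PercEventualDensity
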